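import Summits.Ventures.PercRepro.Night2FatZOneE
import Summits.Ventures.PercRepro.Night2FatZTwo

/-!
# night-2: the non-degenerate two-planes regime is closed — every lossy basis pair, and the local Hall inequality

A lossy basis pair of the non-degenerate two-planes regime has `0`, `1` or `2` basis points on the spine (the spine has
rank `2` and `P₀` is independent); `basis_pair_fair_fat_of_two_planes_of_no_basis_point` / `…_of_one_basis_point` (for
either plane, by the symmetry `c₂ ↔ c₃` of the regime data) / `…_of_two_basis_points` give its fair share:
**`basis_pair_fair_fat_of_two_planes_nondeg`**.  With the fat split of every lossy basis pair (`exists_fat_split`) and the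
column side (`localShadowHall_of_gt2_of_basis_fair`): **`localShadowHall_fat_of_two_planes_nondeg`** — THE (2,1) CELL
WITH A FAT CLOSURE WHOSE `H₀` IS THE UNION OF TWO PLANES THROUGH A LINE COPLANAR WITH THE OFF-POINTS, EACH PLANE CARRYING
THREE NON-COLLINEAR POINTS OFF THE LINE, SATISFIES THE LOCAL HALL INEQUALITY FOR EVERY `|G|`.  Together with
`localShadowHall_fat_of_good` this leaves, of the whole fat case, only the DEGENERATE two-planes regime (one plane = the
spine and a second line).  Paper `proofs/NIGHT-2-g34.md` §6.
-/

namespace PercRepro.Shadow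

open PercRepro.ThmH PercRepro.PerFlat

variable {α : Type*} [DecidableEq α] {M : Matroid α} [M.Finite] {G : Finset α}

/-- **The fair share of every lossy basis pair of the non-degenerate two-planes regime.** -/
theorem basis_pair_fair_fat_of_two_planes_nondeg (hG : G ∈ flatsQ M (5 + 1)) (hd : (gr M \ G).card = 2)
    (hk : kColoops M G = 1) (hs : ∀ e ∈ gr M, ∀ f ∈ gr M, e ≠ f → rkN M {e, f} = 2)
    (hl : ∀ e ∈ gr M, M.Indep {e}) (hfat : (fatClosures M 5 G 2).card ≤ 1)
    {B₀ : Finset α} (hB₀ : B₀ ∈ thinMembers M 5 G) {w₀ x : α} (hD : G \ clF M B₀ = {w₀, x}) (hne : w₀ ≠ x)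
    {R₁ : Finset α}
    (hR₁V : R₁ ⊆ (G \ coloops M G) \ {w₀, x}) (hR₁2 : rkN M R₁ = 2) (hR₁3 : 3 ≤ R₁.card) {c₂ c₃ : α}
    (hc₂V : c₂ ∈ (G \ coloops M G) \ {w₀, x}) (hc₃V : c₃ ∈ (G \ coloops M G) \ {w₀, x})
    (hc₂ : c₂ ∉ clF M R₁) (hc₃ : c₃ ∉ clF M (insert c₂ R₁))
    (hcover : ∀ e ∈ (G \ coloops M G) \ {w₀, x}, e ∈ clF M (insert c₂ R₁) ∨ e ∈ clF M (insert c₃ R₁))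
    (hnd₂ : 3 ≤ rkN M (((G \ coloops M G) \ {w₀, x}).filter
      (fun e => e ∈ clF M (insert c₂ R₁) ∧ e ∉ clF M R₁)))
    (hnd₃ : 3 ≤ rkN M (((G \ coloops M G) \ {w₀, x}).filter
      (fun e => e ∈ clF M (insert c₃ R₁) ∧ e ∉ clF M R₁)))
    {B : Finset α} (hB : B ∈ thinMembers M 5 G) (hnP : ¬ bigP M G B) {z : α} (hz : z ∈ G \ clF M B)
    (hl0 : loss M 5 G B z ≠ 0) (hw₀ : w₀ ∈ insert z B) (hx : x ∉ insert z B) :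
    loss M 5 G B z ≤ rhoL M 5 G B z * lossIncomeH M 5 G (bigP M G) (dshGT2 M 5 G) B z := by
  have hd' : (gr M \ G).card ≤ 5 := by omega
  have hGg : G ⊆ gr M := (mem_flatsQ.1 hG).1
  have hQG : insert z B ⊆ G :=
    Finset.insert_subset (Finset.mem_sdiff.1 hz).1 (subset_G_of_mem_thinMembers hB)
  have hVg : (G \ coloops M G) \ {w₀, x} ⊆ gr M := fun e he =>
    hGg (Finset.mem_sdiff.1 (Finset.mem_sdiff.1 he).1).1
  have hR₁g : R₁ ⊆ gr M := hR₁V.trans hVg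
  have hc₂g : c₂ ∈ gr M := hVg hc₂V
  have hc₃g : c₃ ∈ gr M := hVg hc₃V
  set P₀ := (insert z B \ coloops M G).erase w₀ with hP₀
  have hQ5 := card_insert_sdiff_eq_five hG hd hk hB hnP hz
  have hrk5 := rkN_insert_sdiff_coloops_eq_five_of_thin hG hd hk hB hz
  have hind : M.Indep ((insert z B \ coloops M G : Finset α) : Set α) :=
    indep_of_rkN_eq_card (by rw [hrk5, hQ5])
  have hP₀ind : M.Indep (P₀ : Set α) := hind.subset (by exact_mod_cast (Finset.erase_subset _ _))
  have hindep_card : ∀ S : Finset α, S ⊆ P₀ → ∀ X : Finset α, S ⊆ clF M X → S.card ≤ rkN M X := by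
    intro S hS X hSX
    have := rkN_mono (M := M) hSX
    rw [rkN_clF, rkN_eq_card_of_indep (hP₀ind.subset (by exact_mod_cast hS))] at this
    exact this
  have hw₀K : w₀ ∉ coloops M G := by
    intro h'
    have h1 : w₀ ∈ clF M B₀ := subset_clF_of_subset_gr ((subset_G_of_mem_thinMembers hB₀).trans hGg)
      (coloops_subset_of_mem_thinMembers hG hd' hB₀ h')
    have h2 : w₀ ∈ G \ clF M B₀ := by
      rw [hD]
      exact Finset.mem_insert_self _ _
    exact (Finset.mem_sdiff.1 h2).2 h1
  have hP₀4 : P₀.card = 4 := by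
    rw [hP₀, Finset.card_erase_of_mem (Finset.mem_sdiff.2 ⟨hw₀, hw₀K⟩), hQ5]
  have hP₀Q : ∀ e, e ∈ insert z B \ coloops M G → e ∈ clF M R₁ → e ∈ P₀ := by
    intro e he heL
    refine Finset.mem_erase.2 ⟨?_, he⟩
    rintro rfl
    have : e ∈ clF M B₀ := by
      have hR₁B : R₁ ⊆ clF M B₀ := by
        intro r hr
        have hrV := hR₁V hr
        rw [Finset.mem_sdiff, Finset.mem_sdiff, Finset.mem_insert, Finset.mem_singleton, not_or] at hrV
        by_contra hrB
        have : r ∈ G \ clF M B₀ := Finset.mem_sdiff.2 ⟨hrV.1.1, hrB⟩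
        rw [hD, Finset.mem_insert, Finset.mem_singleton] at this
        rcases this with h | h
        · exact hrV.2.1 h
        · exact hrV.2.2 h
      exact clF_subset_clF_of_subset_clF hR₁B heL
    have h2 : e ∈ G \ clF M B₀ := by
      rw [hD]
      exact Finset.mem_insert_self _ _
    exact (Finset.mem_sdiff.1 h2).2 this
  -- the basis points on the spine: at most two
  set L₀ := P₀.filter (fun e => e ∈ clF M R₁) with hL₀
  have hL₀2 : L₀.card ≤ 2 := by
    have := hindep_card L₀ (Finset.filter_subset _ _) R₁ (fun e he => (Finset.mem_filter.1 he).2)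
    rw [hR₁2] at this
    exact this
  rcases Nat.lt_or_ge L₀.card 1 with h0 | h1
  · -- no basis point on the spine
    have hL₀0 : L₀ = ∅ := Finset.card_eq_zero.1 (by omega)
    have hP₀L : ∀ a ∈ insert z B \ coloops M G, a ∉ clF M R₁ := by
      intro a ha haL
      have : a ∈ L₀ := by
        rw [hL₀, Finset.mem_filter]
        exact ⟨hP₀Q a ha haL, haL⟩
      rw [hL₀0] at this
      exact Finset.notMem_empty _ this
    exact basis_pair_fair_fat_of_two_planes_of_no_basis_point hG hd hk hs hl hfat hB₀ hD hne hR₁V hR₁2 hR₁3 hc₂V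
      hc₃V hc₂ hc₃ hcover hnd₂ hnd₃ hB hnP hz hl0 hw₀ hx hP₀L
  rcases Nat.lt_or_ge L₀.card 2 with h1' | h2
  · -- exactly one basis point `a` on the spine
    obtain ⟨a, haL₀⟩ := Finset.card_eq_one.1 (by omega : L₀.card = 1)
    have haP : a ∈ P₀ := (Finset.mem_filter.1 (by rw [haL₀]; exact Finset.mem_singleton_self a : a ∈ L₀)).1
    have haL : a ∈ clF M R₁ := (Finset.mem_filter.1 (by rw [haL₀]; exact Finset.mem_singleton_self a : a ∈ L₀)).2
    have hP₀a : ∀ e ∈ insert z B \ coloops M G, e ∈ clF M R₁ → e = a := by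
      intro e he heL
      have : e ∈ L₀ := by
        rw [hL₀, Finset.mem_filter]
        exact ⟨hP₀Q e he heL, heL⟩
      rw [haL₀, Finset.mem_singleton] at this
      exact this
    -- the three other basis points lie off the spine, at most two in each plane
    have hplane : ∀ c : α, c ∈ gr M → c ∉ clF M R₁ →
        (P₀.filter (fun e => e ∈ clF M (insert c R₁) ∧ e ∉ clF M R₁)).card ≤ 2 := by
      intro c hcg hcL
      have hrk : rkN M (insert c R₁) = 3 := by rw [rkN_insert_of_notMem_clF hcg hcL, hR₁2]
      have hsub : insert a (P₀.filter (fun e => e ∈ clF M (insert c R₁) ∧ e ∉ clF M R₁)) ⊆ P₀ :=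
        Finset.insert_subset haP (Finset.filter_subset _ _)
      have hsubc : insert a (P₀.filter (fun e => e ∈ clF M (insert c R₁) ∧ e ∉ clF M R₁)) ⊆ clF M (insert c R₁) := by
        intro e he
        rw [Finset.mem_insert] at he
        rcases he with rfl | he
        · exact clF_mono (Finset.subset_insert _ _) haL
        · exact (Finset.mem_filter.1 he).2.1
      have h := hindep_card _ hsub _ hsubc
      rw [hrk, Finset.card_insert_of_notMem (fun h' => (Finset.mem_filter.1 h').2.2 haL)] at h
      omega
    set P₂ := P₀.filter (fun e => e ∈ clF M (insert c₂ R₁) ∧ e ∉ clF M R₁) with hP₂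
    set P₃ := P₀.filter (fun e => e ∈ clF M (insert c₃ R₁) ∧ e ∉ clF M R₁) with hP₃
    have hP₂2 : P₂.card ≤ 2 := hplane c₂ hc₂g hc₂
    have hc₃L : c₃ ∉ clF M R₁ := fun h' => hc₃ (clF_mono (Finset.subset_insert _ _) h')
    have hP₃2 : P₃.card ≤ 2 := hplane c₃ hc₃g hc₃L
    have hP₀V : P₀ ⊆ (G \ coloops M G) \ {w₀, x} := by
      intro e he
      rw [hP₀, Finset.mem_erase, Finset.mem_sdiff] at he
      rw [Finset.mem_sdiff, Finset.mem_sdiff, Finset.mem_insert, Finset.mem_singleton]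
      refine ⟨⟨hQG he.2.1, he.2.2⟩, ?_⟩
      rintro (rfl | rfl)
      · exact he.1 rfl
      · exact hx he.2.1
    have hsplit : P₀.card = L₀.card + P₂.card + P₃.card := by
      have heq : P₀ = L₀ ∪ (P₂ ∪ P₃) := by
        ext e
        rw [Finset.mem_union, Finset.mem_union, hL₀, hP₂, hP₃, Finset.mem_filter, Finset.mem_filter,
          Finset.mem_filter]
        constructor
        · intro he
          by_cases heL : e ∈ clF M R₁
          · exact Or.inl ⟨he, heL⟩
          · rcases hcover e (hP₀V he) with h | h
            · exact Or.inr (Or.inl ⟨he, h, heL⟩)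
            · exact Or.inr (Or.inr ⟨he, h, heL⟩)
        · rintro (h | h | h) <;> exact h.1
      have hd1 : Disjoint L₀ (P₂ ∪ P₃) := by
        rw [Finset.disjoint_left]
        intro e he₁ he₂
        rw [hL₀, Finset.mem_filter] at he₁
        rw [Finset.mem_union, hP₂, hP₃, Finset.mem_filter, Finset.mem_filter] at he₂
        rcases he₂ with h | h <;> exact h.2.2 he₁.2
      have hd2 : Disjoint P₂ P₃ := by
        rw [Finset.disjoint_left]
        intro e he₁ he₂
        rw [hP₂, Finset.mem_filter] at he₁
        rw [hP₃, Finset.mem_filter] at he₂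
        exact he₁.2.2 (mem_clF_of_mem_two_planes hR₁g hc₂g hc₃g hc₂ hc₃ he₁.2.1 he₂.2.1)
      rw [heq, Finset.card_union_of_disjoint hd1, Finset.card_union_of_disjoint hd2]
      omega
    rcases Nat.lt_or_ge P₃.card 2 with h31 | h32
    · -- `π₃` carries exactly one basis point `d` off the spine
      have hP₃1 : P₃.card = 1 := by omega
      obtain ⟨d, hdP₃⟩ := Finset.card_eq_one.1 hP₃1
      have hdmem : d ∈ P₃ := by rw [hdP₃]; exact Finset.mem_singleton_self d
      rw [hP₃, Finset.mem_filter] at hdmem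
      have hP₀d : ∀ e ∈ insert z B \ coloops M G, e ∈ clF M (insert c₃ R₁) → e ∉ clF M R₁ → e = d := by
        intro e he he3 heL
        have heP₀ : e ∈ P₀ := by
          refine Finset.mem_erase.2 ⟨?_, he⟩
          rintro rfl
          have hw₀c : e ∈ clF M B₀ := by
            -- `π₃ ⊆ clF B₀`: both `R₁` and `c₃` lie in `clF B₀`
            have hR₁B : R₁ ⊆ clF M B₀ := by
              intro r hr
              have hrV := hR₁V hr
              rw [Finset.mem_sdiff, Finset.mem_sdiff, Finset.mem_insert, Finset.mem_singleton, not_or] at hrV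
              by_contra hrB
              have : r ∈ G \ clF M B₀ := Finset.mem_sdiff.2 ⟨hrV.1.1, hrB⟩
              rw [hD, Finset.mem_insert, Finset.mem_singleton] at this
              rcases this with h | h
              · exact hrV.2.1 h
              · exact hrV.2.2 h
            have hc₃B : c₃ ∈ clF M B₀ := by
              have hcV := hc₃V
              rw [Finset.mem_sdiff, Finset.mem_sdiff, Finset.mem_insert, Finset.mem_singleton, not_or] at hcV
              by_contra hcB
              have : c₃ ∈ G \ clF M B₀ := Finset.mem_sdiff.2 ⟨hcV.1.1, hcB⟩
              rw [hD, Finset.mem_insert, Finset.mem_singleton] at this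
              rcases this with h | h
              · exact hcV.2.1 h
              · exact hcV.2.2 h
            exact clF_subset_clF_of_subset_clF (Finset.insert_subset hc₃B hR₁B) he3
          have h2 : e ∈ G \ clF M B₀ := by
            rw [hD]
            exact Finset.mem_insert_self _ _
          exact (Finset.mem_sdiff.1 h2).2 hw₀c
        have : e ∈ P₃ := by
          rw [hP₃, Finset.mem_filter]
          exact ⟨heP₀, he3, heL⟩
        rw [hdP₃, Finset.mem_singleton] at this
        exact this
      exact basis_pair_fair_fat_of_two_planes_of_one_basis_point hG hd hk hs hl hfat hB₀ hD hne hR₁V hR₁2 hR₁3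
        hc₂V hc₃V hc₂ hc₃ hcover hnd₂ hnd₃ hB hnP hz hl0 hw₀ hx haP haL hP₀a hdmem.1 hdmem.2.2 hP₀d
    · -- `π₂` carries exactly one basis point `d` off the spine: the symmetric situation
      have hP₂1 : P₂.card = 1 := by omega
      obtain ⟨d, hdP₂⟩ := Finset.card_eq_one.1 hP₂1
      have hdmem : d ∈ P₂ := by rw [hdP₂]; exact Finset.mem_singleton_self d
      rw [hP₂, Finset.mem_filter] at hdmem
      have hc₂π₃ : c₂ ∉ clF M (insert c₃ R₁) := notMem_clF_insert_of_notMem_clF_insert hR₁g hc₂g hc₃g hc₂ hc₃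
      have hP₀d : ∀ e ∈ insert z B \ coloops M G, e ∈ clF M (insert c₂ R₁) → e ∉ clF M R₁ → e = d := by
        intro e he he2 heL
        have heP₀ : e ∈ P₀ := by
          refine Finset.mem_erase.2 ⟨?_, he⟩
          rintro rfl
          have hw₀c : e ∈ clF M B₀ := by
            have hR₁B : R₁ ⊆ clF M B₀ := by
              intro r hr
              have hrV := hR₁V hr
              rw [Finset.mem_sdiff, Finset.mem_sdiff, Finset.mem_insert, Finset.mem_singleton, not_or] at hrV
              by_contra hrB
              have : r ∈ G \ clF M B₀ := Finset.mem_sdiff.2 ⟨hrV.1.1, hrB⟩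
              rw [hD, Finset.mem_insert, Finset.mem_singleton] at this
              rcases this with h | h
              · exact hrV.2.1 h
              · exact hrV.2.2 h
            have hc₂B : c₂ ∈ clF M B₀ := by
              have hcV := hc₂V
              rw [Finset.mem_sdiff, Finset.mem_sdiff, Finset.mem_insert, Finset.mem_singleton, not_or] at hcV
              by_contra hcB
              have : c₂ ∈ G \ clF M B₀ := Finset.mem_sdiff.2 ⟨hcV.1.1, hcB⟩
              rw [hD, Finset.mem_insert, Finset.mem_singleton] at this
              rcases this with h | h
              · exact hcV.2.1 h
              · exact hcV.2.2 h
            exact clF_subset_clF_of_subset_clF (Finset.insert_subset hc₂B hR₁B) he2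
          have h2 : e ∈ G \ clF M B₀ := by
            rw [hD]
            exact Finset.mem_insert_self _ _
          exact (Finset.mem_sdiff.1 h2).2 hw₀c
        have : e ∈ P₂ := by
          rw [hP₂, Finset.mem_filter]
          exact ⟨heP₀, he2, heL⟩
        rw [hdP₂, Finset.mem_singleton] at this
        exact this
      exact basis_pair_fair_fat_of_two_planes_of_one_basis_point hG hd hk hs hl hfat hB₀ hD hne hR₁V hR₁2 hR₁3
        hc₃V hc₂V hc₃L hc₂π₃ (fun e he => (hcover e he).symm) hnd₃ hnd₂ hB hnP hz hl0 hw₀ hx haP haL hP₀a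
        hdmem.1 hdmem.2.2 hP₀d
  · -- two basis points on the spine
    obtain ⟨a, b, ha, hb, hab⟩ := Finset.one_lt_card_iff.1 (by omega : 1 < L₀.card)
    rw [hL₀, Finset.mem_filter] at ha hb
    exact basis_pair_fair_fat_of_two_planes_of_two_basis_points hG hd hk hs hl hfat hB₀ hD hne hR₁V hR₁2 hR₁3 hc₂V
      hc₃V hc₂ hc₃ hcover hnd₂ hnd₃ hB hnP hz hl0 hw₀ hx ha.1 hb.1 hab ha.2 hb.2

/-- **THE (2,1) CELL WITH A FAT CLOSURE IN THE NON-DEGENERATE TWO-PLANES REGIME SATISFIES THE LOCAL HALL INEQUALITY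
FOR EVERY `|G|`**: `H₀ = clF (insert c₂ R₁) ∪ clF (insert c₃ R₁)` for a line `R₁` of `≥ 3` points coplanar with the two
off-points `w₀, x`, each plane carrying points off the spine of rank `≥ 3`. -/
theorem localShadowHall_fat_of_two_planes_nondeg (hG : G ∈ flatsQ M (5 + 1)) (hd : (gr M \ G).card = 2)
    (hk : kColoops M G = 1) (hs : ∀ e ∈ gr M, ∀ f ∈ gr M, e ≠ f → rkN M {e, f} = 2)
    (hl : ∀ e ∈ gr M, M.Indep {e}) (hfat : (fatClosures M 5 G 2).card ≤ 1)
    {B₀ : Finset α} (hB₀ : B₀ ∈ thinMembers M 5 G) {w₀ x : α} (hD : G \ clF M B₀ = {w₀, x}) (hne : w₀ ≠ x)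
    {R₁ : Finset α}
    (hR₁V : R₁ ⊆ (G \ coloops M G) \ {w₀, x}) (hR₁2 : rkN M R₁ = 2) (hR₁3 : 3 ≤ R₁.card) {c₂ c₃ : α}
    (hc₂V : c₂ ∈ (G \ coloops M G) \ {w₀, x}) (hc₃V : c₃ ∈ (G \ coloops M G) \ {w₀, x})
    (hc₂ : c₂ ∉ clF M R₁) (hc₃ : c₃ ∉ clF M (insert c₂ R₁))
    (hcover : ∀ e ∈ (G \ coloops M G) \ {w₀, x}, e ∈ clF M (insert c₂ R₁) ∨ e ∈ clF M (insert c₃ R₁))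
    (hnd₂ : 3 ≤ rkN M (((G \ coloops M G) \ {w₀, x}).filter
      (fun e => e ∈ clF M (insert c₂ R₁) ∧ e ∉ clF M R₁)))
    (hnd₃ : 3 ≤ rkN M (((G \ coloops M G) \ {w₀, x}).filter
      (fun e => e ∈ clF M (insert c₃ R₁) ∧ e ∉ clF M R₁))) :
    LocalShadowHall M 5 G := by
  apply localShadowHall_of_gt2_of_basis_fair hG hd hk hs hl hfat
  intro B hB hnP z hz
  have hd' : (gr M \ G).card ≤ 5 := by omega
  by_cases hl0 : loss M 5 G B z = 0
  · rw [hl0]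
    have h1 : 0 ≤ rhoL M 5 G B z := by
      unfold rhoL
      rw [hl0]
      simp
    have h2 : 0 ≤ lossIncomeH M 5 G (bigP M G) (dshGT2 M 5 G) B z :=
      lossIncomeH_nonneg hG hd' (column_side_gt2 hG hd hk hs hl hfat) B z
    positivity
  · have hm₀ : (G \ clF M B₀).card = 2 := by rw [hD, Finset.card_pair hne]
    obtain ⟨u, v, hD', hne', hu, hv⟩ := exists_fat_split hG hd hk hB₀ hm₀ hB hz hl0
    have hpair : ({u, v} : Finset α) = {w₀, x} := by rw [← hD', hD]
    have hR₁V' : R₁ ⊆ (G \ coloops M G) \ {u, v} := by rw [hpair]; exact hR₁V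
    have hc₂V' : c₂ ∈ (G \ coloops M G) \ {u, v} := by rw [hpair]; exact hc₂V
    have hc₃V' : c₃ ∈ (G \ coloops M G) \ {u, v} := by rw [hpair]; exact hc₃V
    have hcover' : ∀ e ∈ (G \ coloops M G) \ {u, v}, e ∈ clF M (insert c₂ R₁) ∨ e ∈ clF M (insert c₃ R₁) := by
      rw [hpair]; exact hcover
    have hnd₂' : 3 ≤ rkN M (((G \ coloops M G) \ {u, v}).filter
        (fun e => e ∈ clF M (insert c₂ R₁) ∧ e ∉ clF M R₁)) := by rw [hpair]; exact hnd₂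
    have hnd₃' : 3 ≤ rkN M (((G \ coloops M G) \ {u, v}).filter
        (fun e => e ∈ clF M (insert c₃ R₁) ∧ e ∉ clF M R₁)) := by rw [hpair]; exact hnd₃
    exact basis_pair_fair_fat_of_two_planes_nondeg hG hd hk hs hl hfat hB₀ hD' hne' hR₁V' hR₁2 hR₁3 hc₂V' hc₃V' hc₂
      hc₃ hcover' hnd₂' hnd₃' hB hnP hz hl0 hu hv

/-- **THE FAT CASE OF (FAIR) UNDER THE NON-DEGENERACY HYPOTHESIS (HND)**: for every line `R` of `≥ 3` points of
`H₀ = (G ∖ K) ∖ (G ∖ clF B₀)` coplanar with the two off-points and every plane `clF (insert c R)` through it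
(`c ∈ H₀ ∖ clF R`), the points of `H₀` outside that plane have rank `≥ 3`.  Either every lossy big pair has a good
point (`localShadowHall_fat_of_good`) or some lossy big pair has none, `H₀` is the union of two planes through such a
line (`exists_two_planes_of_no_gtPts`) and (HND) says the regime is non-degenerate
(`localShadowHall_fat_of_two_planes_nondeg`).  The remaining gap of the fat case is therefore exactly the negation of
(HND) at a lossy big pair without good points: one of the two planes carries collinear points off the spine. -/
theorem localShadowHall_fat_of_hnd (hG : G ∈ flatsQ M (5 + 1)) (hd : (gr M \ G).card = 2)
    (hk : kColoops M G = 1) (hs : ∀ e ∈ gr M, ∀ f ∈ gr M, e ≠ f → rkN M {e, f} = 2)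
    (hl : ∀ e ∈ gr M, M.Indep {e}) (hfat : (fatClosures M 5 G 2).card ≤ 1)
    {B₀ : Finset α} (hB₀ : B₀ ∈ thinMembers M 5 G) (hm₀ : (G \ clF M B₀).card = 2)
    (hHND : ∀ R ⊆ (G \ coloops M G) \ (G \ clF M B₀), rkN M R = 2 → 3 ≤ R.card →
      rkN M (R ∪ (G \ clF M B₀)) ≤ 3 → ∀ c ∈ (G \ coloops M G) \ (G \ clF M B₀), c ∉ clF M R →
      3 ≤ rkN M (((G \ coloops M G) \ (G \ clF M B₀)).filter (fun e => e ∉ clF M (insert c R)))) :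
    LocalShadowHall M 5 G := by
  by_cases hgood : ∀ B ∈ thinMembers M 5 G, 5 ≤ (B \ coloops M G).card → ∀ z ∈ G \ clF M B,
      loss M 5 G B z ≠ 0 → (gtPts M 5 G (insert z B)).Nonempty
  · exact localShadowHall_fat_of_good hG hd hk hs hl hfat hB₀ hm₀ hgood
  · -- a lossy big pair without good points: the two-planes regime
    obtain ⟨B, hB, hbig, z, hz, hloss, hno⟩ : ∃ B ∈ thinMembers M 5 G, 5 ≤ (B \ coloops M G).card ∧
        ∃ z ∈ G \ clF M B, loss M 5 G B z ≠ 0 ∧ ¬ (gtPts M 5 G (insert z B)).Nonempty := by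
      by_contra hcon
      apply hgood
      intro B hB hbig z hz hloss
      by_contra hno
      exact hcon ⟨B, hB, hbig, z, hz, hloss, hno⟩
    obtain ⟨w₀, x, hne, hD⟩ := Finset.card_eq_two.1 hm₀
    obtain ⟨R₁, hR₁Q, hR₁2, hR₁3, -, hcop, c₂, hc₂Q, c₃, hc₃Q, hc₂, hc₃, hcover⟩ :=
      exists_two_planes_of_no_gtPts hG hd hk hs hl hB₀ hD hB hbig hz hloss hno
    have hGg : G ⊆ gr M := (mem_flatsQ.1 hG).1
    have hd' : (gr M \ G).card ≤ 5 := by omega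
    have hQG : insert z B ⊆ G :=
      Finset.insert_subset (Finset.mem_sdiff.1 hz).1 (subset_G_of_mem_thinMembers hB)
    have hQV : (insert z B \ coloops M G) \ {w₀, x} ⊆ (G \ coloops M G) \ {w₀, x} :=
      Finset.sdiff_subset_sdiff (Finset.sdiff_subset_sdiff hQG (Finset.Subset.refl _)) (Finset.Subset.refl _)
    have hR₁V : R₁ ⊆ (G \ coloops M G) \ {w₀, x} := hR₁Q.trans hQV
    have hc₂V : c₂ ∈ (G \ coloops M G) \ {w₀, x} := hQV hc₂Q
    have hc₃V : c₃ ∈ (G \ coloops M G) \ {w₀, x} := hQV hc₃Q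
    have hVg : (G \ coloops M G) \ {w₀, x} ⊆ gr M := fun e he =>
      hGg (Finset.mem_sdiff.1 (Finset.mem_sdiff.1 he).1).1
    have hR₁g : R₁ ⊆ gr M := hR₁V.trans hVg
    have hc₂g : c₂ ∈ gr M := hVg hc₂V
    have hc₃g : c₃ ∈ gr M := hVg hc₃V
    have hc₃L : c₃ ∉ clF M R₁ := fun h' => hc₃ (clF_mono (Finset.subset_insert _ _) h')
    have hc₂π₃ : c₂ ∉ clF M (insert c₃ R₁) := notMem_clF_insert_of_notMem_clF_insert hR₁g hc₂g hc₃g hc₂ hc₃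
    -- the (HND) hypothesis in the vocabulary of `w₀, x`
    have hcop' : rkN M (R₁ ∪ ({w₀, x} : Finset α)) ≤ 3 := by
      have heq : R₁ ∪ ({w₀, x} : Finset α) = insert w₀ (insert x R₁) := by
        ext e
        simp only [Finset.mem_union, Finset.mem_insert, Finset.mem_singleton]
        tauto
      rw [heq]
      exact hcop
    rw [hD] at hHND
    -- the points off one plane are the points of the other plane off the spine
    have hfilter : ∀ u v : α, u ∈ gr M → v ∈ gr M → u ∉ clF M R₁ → v ∉ clF M (insert u R₁) →
        (∀ e ∈ (G \ coloops M G) \ {w₀, x}, e ∈ clF M (insert u R₁) ∨ e ∈ clF M (insert v R₁)) →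
        ((G \ coloops M G) \ {w₀, x}).filter (fun e => e ∉ clF M (insert u R₁)) =
          ((G \ coloops M G) \ {w₀, x}).filter (fun e => e ∈ clF M (insert v R₁) ∧ e ∉ clF M R₁) := by
      intro u v hug hvg hu hv hcov
      ext e
      simp only [Finset.mem_filter]
      constructor
      · rintro ⟨heV, heu⟩
        refine ⟨heV, ?_, fun heL => heu (clF_mono (Finset.subset_insert _ _) heL)⟩
        rcases hcov e heV with h | h
        · exact absurd h heu
        · exact h
      · rintro ⟨heV, hev, heL⟩
        refine ⟨heV, fun heu => heL ?_⟩
        exact mem_clF_of_mem_two_planes hR₁g hug hvg hu hv heu hev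
    have hnd₃ : 3 ≤ rkN M (((G \ coloops M G) \ {w₀, x}).filter
        (fun e => e ∈ clF M (insert c₃ R₁) ∧ e ∉ clF M R₁)) := by
      rw [← hfilter c₂ c₃ hc₂g hc₃g hc₂ hc₃ hcover]
      exact hHND R₁ hR₁V hR₁2 hR₁3 hcop' c₂ hc₂V hc₂
    have hnd₂ : 3 ≤ rkN M (((G \ coloops M G) \ {w₀, x}).filter
        (fun e => e ∈ clF M (insert c₂ R₁) ∧ e ∉ clF M R₁)) := by
      rw [← hfilter c₃ c₂ hc₃g hc₂g hc₃L hc₂π₃ (fun e he => (hcover e he).symm)]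
      exact hHND R₁ hR₁V hR₁2 hR₁3 hcop' c₃ hc₃V hc₃L
    exact localShadowHall_fat_of_two_planes_nondeg hG hd hk hs hl hfat hB₀ hD hne hR₁V hR₁2 hR₁3 hc₂V hc₃V hc₂ hc₃
      hcover hnd₂ hnd₃

end PercRepro.Shadow
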